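import Summits.BirchSwinnertonDyer.Rank1Residual.Additive.RamifiedOrdinaryLineTorsionFixed
import Summits.BirchSwinnertonDyer.Rank1Residual.Additive.GreenbergVatsalTransferRamifiedQuotient
import Summits.BirchSwinnertonDyer.Rank1Residual.Additive.BudgetFromRationalClasses
import Summits.BirchSwinnertonDyer.Rank1Residual.X2.GreenbergVatsalTransferCurve
import Literature.NumberTheory.EllipticCurves.IwasawaTowerTorsionProofs
import HarnessLib

/-!
# "The order of `S^{Σ₀}_{E_i[3]}(ℚ_∞)` is independent of `i`" on the cell's `p = 3` rows — the
# Greenberg–Vatsal transfer COUNT for two `3`-congruent curves of X4♯(G-ord) (resp. X3♯(G-ord)) at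
# the additive prime `3`, EVERY local hypothesis discharged (cell `b2b-bsdres`, team n1011, seat p12
# (gen 4); row T-E3g-GV29 FILE 6 = the capstone of FILES 1–5; ROUTE-2 II.15.4 ARM α, kernel half)

HONEST FRAMING (cell `b2b-bsdres`, run/shared/lean/b2b/bsd-rank1-residual/, verbatim in every
file): the goal of the cell is to DELETE the COMBINATION-SHAPED residual classes of the
Birch–Swinnerton-Dyer formula for ALL analytic-rank `≤ 1` elliptic curves over `ℚ` — "full BSD
formula for every rank `≤ 1` curve in class `C`" assembled STRICTLY from published theorems — so
that the rank-`≤ 1` remainder becomes exactly the CONSTRUCTION-SHAPED classes, which are TYPED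
(missing-input `Prop`s), NOT attempted. This is not "finishing BSD". Team n1011: research routes on
CONSTRUCTION-SHAPED classes; prove what is provable now; no claim beyond stated classes; census
output = EVIDENCE, never a Literature fact; RESIDUAL-MAP marks UNCHANGED; nothing is booked by this
file. THEOREMS ONLY: no definition, no named fact.

## What

For `E₁, E₂/ℚ` globally minimal, BOTH in X4♯(G-ord) at `3` (additive potentially good ordinary,
`e = 2`, `E_i[3]` irreducible) — resp. both in X3♯(G-ord) at `3` with `3 ∤ #E_i(ℚ)_tors` — good outside
`S₀ ∪ {3}`, and `E₁[3] ≅ E₂[3]` as `Γ_ℚ`-modules (route G's `TorsionIso`): there are ramified ordinary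
data `L_i` at `3` (FILE 5: `C_i` divisible proper, `(E_i[3^∞]/C_i)^{ker κ ⊓ I} = 0`,
`C_i ∩ E_i[3] = E_i[3]^{I}`) with
**`#(S^{S₀}_{E₁[3^∞]}(ℚ_∞) ⊓ H¹[3]) = #(S^{S₀}_{E₂[3^∞]}(ℚ_∞) ⊓ H¹[3])`** — GV p. 27, verbatim
shape, at an ADDITIVE prime, for reducible `E_i[3]` too, with NO `H⁰ = 0` hypothesis needed
(`E_i(ℚ_∞)[3^∞] = 0` from `E_i(ℚ)[3] = 0`, tree `fixedPoints_kerSubgroup_geomPrimaryTorsion_eq_bot`).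
Inputs: FILE 2's `natCard_gvSelmer_inf_torsion_mul_eq_curve_of_fixedPoints`, FILE 5's
`ClassX4Gord/ClassX3Gord.exists_isRamifiedOrdinaryLine_flipped_three`, eisenstein-p2's
`X2.GreenbergVatsalTransferCurve.exists_equiv_of_torsionIso`, p10's no-`p`-torsion lemmas. What this
does NOT give: the LINK `Sel_{3^∞}(E_i/ℚ_∞) = S(ℚ_∞)` (T-RD-Δ) and the `λ`-reading (Props. (2.5)/(2.8)
second half, Cor. (2.3)) — typed elsewhere; hence no `λ`-statement and nothing booked.

References: [GreenbergVatsal2000] §2 Prop. (2.8), Remark (2.9), pp. 26–27; ROUTE-2 II.15.4.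
-/

set_option autoImplicit false

noncomputable section

open scoped Classical NumberField AddSubgroup

open NumberField IsDedekindDomain Field WeierstrassCurve
  Literature.NumberTheory.GaloisRepresentations Literature.NumberTheory.EllipticCurves
  Literature.NumberTheory.EllipticCurves.GreenbergSelmer
  Literature.NumberTheory.EllipticCurves.EmertonPollackWeston2006
  Literature.NumberTheory.EllipticCurves.Rank1Residual
  Summit.BirchSwinnertonDyer.Rank1Residual.X2.TorsionComparison
  Summit.BirchSwinnertonDyer.Rank1Residual.X2.GreenbergVatsalTorsion
  Summit.BirchSwinnertonDyer.Rank1Residual.Additive.GreenbergVatsalTransferRamified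

universe u

namespace Summit.BirchSwinnertonDyer.Rank1Residual.Additive

open Summit.BirchSwinnertonDyer.Rank1Residual.X1.CongruenceTransfer (TorsionIso)

/-! ### §1 `E(ℚ)[p] = 0 ⟹ #E(ℚ_∞)[p^∞][p] = 1` and finiteness -/

section NoTorsion

variable {p : ℕ} [hp : Fact p.Prime] (W : WeierstrassCurve ℚ) [W.IsElliptic] (κ : ZpExtension ℚ p)

/-- `p ∤ #E(ℚ)_tors ⟹ E(ℚ_∞)[p^∞]` is FINITE (indeed `0`: the pro-`p` group `Gal(ℚ_∞/ℚ)` fixes a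
point of any non-zero finite stable subgroup; tree `fixedPoints_kerSubgroup_geomPrimaryTorsion_eq_bot`,
p10's `forall_smul_eq_zero_of_not_dvd_torsionOrder`). [cite: GreenbergLNM1716, §3 Lemma 3.1 (p. 86)] -/
theorem finite_fixedPoints_of_not_dvd_torsionOrder (htors : ¬ p ∣ W.torsionOrder) :
    Finite (FixedPoints.addSubgroup κ.kerSubgroup (W.geomPrimaryTorsion p)) :=
  W.finite_fixedPoints_kerSubgroup_geomPrimaryTorsion κ
    (forall_smul_eq_zero_of_not_dvd_torsionOrder W p htors)

/-- `p ∤ #E(ℚ)_tors ⟹ #E(ℚ_∞)[p^∞][p] = 1`. [cite: GreenbergLNM1716, §3 Lemma 3.1 (p. 86)] -/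
theorem natCard_torsionBy_fixedPoints_eq_one (htors : ¬ p ∣ W.torsionOrder) :
    Nat.card ((FixedPoints.addSubgroup κ.kerSubgroup (W.geomPrimaryTorsion p))[(p : ℤ)]) = 1 := by
  have hbot := W.fixedPoints_kerSubgroup_geomPrimaryTorsion_eq_bot κ
    (forall_smul_eq_zero_of_not_dvd_torsionOrder W p htors)
  haveI : Subsingleton (FixedPoints.addSubgroup κ.kerSubgroup (W.geomPrimaryTorsion p)) := by
    refine ⟨fun a b ↦ Subtype.ext ?_⟩
    have ha : (a : W.geomPrimaryTorsion p) ∈ (⊥ : AddSubgroup (W.geomPrimaryTorsion p)) := by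
      rw [← hbot]; exact a.2
    have hb : (b : W.geomPrimaryTorsion p) ∈ (⊥ : AddSubgroup (W.geomPrimaryTorsion p)) := by
      rw [← hbot]; exact b.2
    rw [AddSubgroup.mem_bot] at ha hb
    rw [ha, hb]
  exact Nat.card_of_subsingleton
    (0 : (FixedPoints.addSubgroup κ.kerSubgroup (W.geomPrimaryTorsion p))[(p : ℤ)])

end NoTorsion

/-! ### §2 The transfer count at `3` on X4♯(G-ord) pairs and on X3♯(G-ord) pairs -/

section Three

variable [hp3 : Fact (Nat.Prime 3)] {W₁ W₂ : WeierstrassCurve ℚ} [W₁.IsElliptic] [W₁.IsGloballyMinimal]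
  [W₂.IsElliptic] [W₂.IsGloballyMinimal] (κ : ZpExtension ℚ 3) (S₀ : Set (HeightOneSpectrum (𝓞 ℚ)))

/-- **GV's transfer count at the additive prime `3`, X4♯(G-ord) pairs, EVERY local hypothesis
discharged.** `E₁, E₂ ∈` X4♯(G-ord) at `3`, good outside `S₀ ∪ {3}`, `E₁[3] ≅ E₂[3]` (`TorsionIso`), `κ`
ANY `ℤ_3`-extension of `ℚ`: there are ramified ordinary data `L₁, L₂` at the places above `3` with
`#(S^{S₀}_{E₁[3^∞]}(ℚ_∞) ⊓ H¹[3]) = #(S^{S₀}_{E₂[3^∞]}(ℚ_∞) ⊓ H¹[3])`. X4♯ stays CONSTRUCTION-SHAPED;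
nothing booked. [cite: GreenbergVatsal2000, §2 Prop. (2.8), Remark (2.9) and pp. 26–27] -/
theorem ClassX4Gord.exists_data_natCard_gvSelmerInfty_inf_torsion_eq_three
    (hX₁ : ClassX4Gord W₁ 3) (hX₂ : ClassX4Gord W₂ 3)
    (hS₁ : ∀ v : HeightOneSpectrum (𝓞 ℚ), v ∉ S₀ → ((3 : ℕ) : 𝓞 ℚ) ∉ v.asIdeal →
      W₁.HasGoodReductionAt v)
    (hS₂ : ∀ v : HeightOneSpectrum (𝓞 ℚ), v ∉ S₀ → ((3 : ℕ) : 𝓞 ℚ) ∉ v.asIdeal →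
      W₂.HasGoodReductionAt v)
    (hT : TorsionIso W₁ W₂ 3) :
    ∃ (L₁ : Data ℚ (W₁.geomPrimaryTorsion 3) 3) (L₂ : Data ℚ (W₂.geomPrimaryTorsion 3) 3),
      (∀ v hv, IsRamifiedOrdinaryLine W₁ 3 (L₁ v hv)) ∧ (∀ v hv, IsRamifiedOrdinaryLine W₂ 3 (L₂ v hv)) ∧
      Nat.card (gvSelmerInfty κ (W₁.geomPrimaryTorsion 3) L₁ S₀ ⊓
          (subgroupH1 κ.kerSubgroup (W₁.geomPrimaryTorsion 3))[((3 : ℕ) : ℤ)] :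
          AddSubgroup (subgroupH1 κ.kerSubgroup (W₁.geomPrimaryTorsion 3))) =
        Nat.card (gvSelmerInfty κ (W₂.geomPrimaryTorsion 3) L₂ S₀ ⊓
          (subgroupH1 κ.kerSubgroup (W₂.geomPrimaryTorsion 3))[((3 : ℕ) : ℤ)] :
          AddSubgroup (subgroupH1 κ.kerSubgroup (W₂.geomPrimaryTorsion 3))) := by
  choose L₁ hL₁ using fun (v : HeightOneSpectrum (𝓞 ℚ)) (hv : ((3 : ℕ) : 𝓞 ℚ) ∈ v.asIdeal) ↦
    ClassX4Gord.exists_isRamifiedOrdinaryLine_flipped_three κ hX₁ hv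
  choose L₂ hL₂ using fun (v : HeightOneSpectrum (𝓞 ℚ)) (hv : ((3 : ℕ) : 𝓞 ℚ) ∈ v.asIdeal) ↦
    ClassX4Gord.exists_isRamifiedOrdinaryLine_flipped_three κ hX₂ hv
  obtain ⟨θ, hθ⟩ := X2.GreenbergVatsalTransferCurve.exists_equiv_of_torsionIso hT
  have hK₁ : ¬ 3 ∣ W₁.torsionOrder := not_dvd_torsionOrder_of_irr' 3 W₁ hX₁.1.2.2
  have hK₂ : ¬ 3 ∣ W₂.torsionOrder := not_dvd_torsionOrder_of_irr' 3 W₂ hX₂.1.2.2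
  haveI := finite_fixedPoints_of_not_dvd_torsionOrder W₁ κ hK₁
  haveI := finite_fixedPoints_of_not_dvd_torsionOrder W₂ κ hK₂
  have h := natCard_gvSelmer_inf_torsion_mul_eq_curve_of_fixedPoints 3 κ.kerSubgroup W₁ W₂ L₁ L₂ S₀
    hS₁ hS₂ (fun v hv ↦ fun _ hm ↦ (hL₁ v hv).1.divisible hm)
    (fun v hv ↦ fun _ hm ↦ (hL₂ v hv).1.divisible hm)
    (fun v hv ↦ (hL₁ v hv).2.1) (fun v hv ↦ (hL₂ v hv).2.1) (fun v hv ↦ (hL₁ v hv).2.2.1)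
    (fun v hv ↦ (hL₂ v hv).2.2.1) (fun v hv ↦ (hL₁ v hv).2.2.2) (fun v hv ↦ (hL₂ v hv).2.2.2) θ hθ
  rw [natCard_torsionBy_fixedPoints_eq_one W₁ κ hK₁, natCard_torsionBy_fixedPoints_eq_one W₂ κ hK₂,
    mul_one, mul_one] at h
  exact ⟨L₁, L₂, fun v hv ↦ (hL₁ v hv).1, fun v hv ↦ (hL₂ v hv).1, h⟩

/-- **GV's transfer count at the additive prime `3`, X3♯(G-ord) pairs (REDUCIBLE `E_i[3]`), EVERY local
hypothesis discharged**, with `3 ∤ #E_i(ℚ)_tors` explicit (the X3 rows' census bit; no image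
hypothesis anywhere). X3♯ stays as labelled; nothing booked.
[cite: GreenbergVatsal2000, §2 Prop. (2.8), Remark (2.9) and pp. 26–27] -/
theorem ClassX3Gord.exists_data_natCard_gvSelmerInfty_inf_torsion_eq_three
    (hX₁ : ClassX3Gord W₁ 3) (hX₂ : ClassX3Gord W₂ 3)
    (htors₁ : ¬ 3 ∣ W₁.torsionOrder) (htors₂ : ¬ 3 ∣ W₂.torsionOrder)
    (hS₁ : ∀ v : HeightOneSpectrum (𝓞 ℚ), v ∉ S₀ → ((3 : ℕ) : 𝓞 ℚ) ∉ v.asIdeal →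
      W₁.HasGoodReductionAt v)
    (hS₂ : ∀ v : HeightOneSpectrum (𝓞 ℚ), v ∉ S₀ → ((3 : ℕ) : 𝓞 ℚ) ∉ v.asIdeal →
      W₂.HasGoodReductionAt v)
    (hT : TorsionIso W₁ W₂ 3) :
    ∃ (L₁ : Data ℚ (W₁.geomPrimaryTorsion 3) 3) (L₂ : Data ℚ (W₂.geomPrimaryTorsion 3) 3),
      (∀ v hv, IsRamifiedOrdinaryLine W₁ 3 (L₁ v hv)) ∧ (∀ v hv, IsRamifiedOrdinaryLine W₂ 3 (L₂ v hv)) ∧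
      Nat.card (gvSelmerInfty κ (W₁.geomPrimaryTorsion 3) L₁ S₀ ⊓
          (subgroupH1 κ.kerSubgroup (W₁.geomPrimaryTorsion 3))[((3 : ℕ) : ℤ)] :
          AddSubgroup (subgroupH1 κ.kerSubgroup (W₁.geomPrimaryTorsion 3))) =
        Nat.card (gvSelmerInfty κ (W₂.geomPrimaryTorsion 3) L₂ S₀ ⊓
          (subgroupH1 κ.kerSubgroup (W₂.geomPrimaryTorsion 3))[((3 : ℕ) : ℤ)] :
          AddSubgroup (subgroupH1 κ.kerSubgroup (W₂.geomPrimaryTorsion 3))) := by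
  choose L₁ hL₁ using fun (v : HeightOneSpectrum (𝓞 ℚ)) (hv : ((3 : ℕ) : 𝓞 ℚ) ∈ v.asIdeal) ↦
    ClassX3Gord.exists_isRamifiedOrdinaryLine_flipped_three κ hX₁ hv
  choose L₂ hL₂ using fun (v : HeightOneSpectrum (𝓞 ℚ)) (hv : ((3 : ℕ) : 𝓞 ℚ) ∈ v.asIdeal) ↦
    ClassX3Gord.exists_isRamifiedOrdinaryLine_flipped_three κ hX₂ hv
  obtain ⟨θ, hθ⟩ := X2.GreenbergVatsalTransferCurve.exists_equiv_of_torsionIso hT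
  have hK₁ := htors₁
  have hK₂ := htors₂
  haveI := finite_fixedPoints_of_not_dvd_torsionOrder W₁ κ hK₁
  haveI := finite_fixedPoints_of_not_dvd_torsionOrder W₂ κ hK₂
  have h := natCard_gvSelmer_inf_torsion_mul_eq_curve_of_fixedPoints 3 κ.kerSubgroup W₁ W₂ L₁ L₂ S₀
    hS₁ hS₂ (fun v hv ↦ fun _ hm ↦ (hL₁ v hv).1.divisible hm)
    (fun v hv ↦ fun _ hm ↦ (hL₂ v hv).1.divisible hm)
    (fun v hv ↦ (hL₁ v hv).2.1) (fun v hv ↦ (hL₂ v hv).2.1) (fun v hv ↦ (hL₁ v hv).2.2.1)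
    (fun v hv ↦ (hL₂ v hv).2.2.1) (fun v hv ↦ (hL₁ v hv).2.2.2) (fun v hv ↦ (hL₂ v hv).2.2.2) θ hθ
  rw [natCard_torsionBy_fixedPoints_eq_one W₁ κ hK₁, natCard_torsionBy_fixedPoints_eq_one W₂ κ hK₂,
    mul_one, mul_one] at h
  exact ⟨L₁, L₂, fun v hv ↦ (hL₁ v hv).1, fun v hv ↦ (hL₂ v hv).1, h⟩

end Three

end Summit.BirchSwinnertonDyer.Rank1Residual.Additive

end
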